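import Mathlib
import HarnessLib
import Literature.Analysis.FluidPDE.TypeIAncientMildRescale
import Literature.Analysis.FluidPDE.AxisymmetricEuler
import Summits.NavierStokesRegularity.NavierStokesRegularity.Theorems.PoloidalWindowDoorPoloidalWindowRigidityNearOneFloor
import Summits.NavierStokesRegularity.NavierStokesRegularity.Theorems.PoloidalWindowDoorPoloidalWindowRigidityHotHullSlabUniform

/-!
# Route `PoloidalWindowDoor`, crux `PoloidalWindowRigidity` (K2, stmt-NavierStokesRegularity-19708) — THICK column, LINE 29 «near_identity» (ns-idea-8) §32–§34, PORTED:
# the VERTICAL SCREW-SCALING GROUP, the ONE-PARAMETER-SUBGROUP EXTRACTION, and the three ENDS of a one-parameter symmetry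

Seat ns-poloidal-K2-p2 g15 (DIRECTOR-NS #306, idea-crit-7's errand R2; `--supports stmt-NavierStokesRegularity-19708 --as helper`).  Source:
`Cruxes/PoloidalWindowRigidity/Lines/near_identity.lean` 63c9d39e624d §32–§34 VERBATIM, except: the objects `IsScrew` / `IsScrewAbout` (and `IsDss`) come from
`…NearIdentityDefs`; the light `rotZ` lemmas are kept PRIVATE (the tree has public copies under several names); `Pinned C v` UNFOLDED VERBATIM;
`class_of_pinned` = `…Window.isTypeIAncientMild_of_class`; LINE 28's `nearOne_anchor` is imported from `…NearOneFloor`.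

* §32 group algebra: `isScrew_zero_iff` (= `IsDss`), `isScrewAbout_zero_iff`, `isScrew_refl`, `IsScrew.mul/.inv/.pow/.zpow`, `isAxisymmetric_of_isScrew`,
  `isDss_of_soliton` (a rotating scaling soliton is DSS with factor `e^{2π/|α|}`).
* §33 `isScrew_of_limit` (closedness of screw symmetry under class limits with MOVING group elements, by the class-uniform slab modulus
  `…HotHullSlabUniform.exists_uniform_slab_modulus`), `tendsto_floor_mul`, `oneParameter_of_limit` (NEAR-IDENTITY SYMMETRIES INTEGRATE: if `gⱼ = (θⱼ, λⱼ) → e` with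
  `(θⱼ, log λⱼ)/εⱼ → (p, q)`, every pointwise class limit is invariant under the one-parameter subgroup `τ ↦ (pτ, e^{qτ})` — the Chabauty extraction).
* §34 the FAST soliton end: `noScrewSoliton_fast` (one full turn is a FINE DSS factor: `nearOne_anchor`).  The axisymmetric end (`axisymmetric_absurd`,
  `not_axisymmetric_pinned`) sits in `…NearIdentityAxisymEnd` (it imports the `AxisymEndLiouville` cone).

WHAT THIS IS NOT: not a claim about Navier–Stokes regularity — ported supports of a files-only line (bears_on LADDER-NS N0, rung N0-LocalTubeDoorPoloidal); hand H1
`NoPinnedScrewSoliton` and LINE 29's research cells, crux 19708 / item 20428, ⟨27893⟩ OPEN; NS regularity NOT proved.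
-/

noncomputable section

-- the summit and its single sub-problem share the name (CONVENTIONS §1), as in every Theorems file
set_option linter.dupNamespace false

namespace Summit.NavierStokesRegularity.NavierStokesRegularity.Theorems.PoloidalWindowDoorPoloidalWindowRigidityNearIdentityExtraction

open Set Function Filter Topology Metric
open scoped InnerProductSpace RealInnerProductSpace Laplacian NNReal
open Literature.Analysis Literature.Analysis.FluidPDE Literature.Analysis.UnboundedOperators
open Summit.NavierStokesRegularity.NavierStokesRegularity.Theorems
open PoloidalWindowDoorPoloidalWindowRigidityNearIdentityDefs PoloidalWindowDoorPoloidalWindowRigidityNearOneFloor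

/-! ## §32 The vertical screw-scaling group (objects in `…NearIdentityDefs`) -/

/-- `R_θ` commutes with scalars (re-proved; light). -/
private theorem rotZ_smul' (θ c : ℝ) (x : EuclideanSpace ℝ (Fin 3)) : rotZ θ (c • x) = c • rotZ θ x := by
  ext i
  fin_cases i <;> simp <;> ring

/-- `R_{−θ} ∘ R_θ = id`. -/
private theorem rotZ_neg_rotZ' (θ : ℝ) (x : EuclideanSpace ℝ (Fin 3)) : rotZ (-θ) (rotZ θ x) = x := by
  rw [← rotZ_add, neg_add_cancel, rotZ_zero]

/-- `R_θ ∘ R_{−θ} = id`. -/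
private theorem rotZ_rotZ_neg' (θ : ℝ) (x : EuclideanSpace ℝ (Fin 3)) : rotZ θ (rotZ (-θ) x) = x := by
  rw [← rotZ_add, add_neg_cancel, rotZ_zero]

/-- A full turn is the identity. -/
private theorem rotZ_two_pi' (x : EuclideanSpace ℝ (Fin 3)) : rotZ (2 * Real.pi) x = x := by
  ext i
  fin_cases i <;> simp

/-- … and so is a full turn backwards. -/
private theorem rotZ_neg_two_pi' (x : EuclideanSpace ℝ (Fin 3)) : rotZ (-(2 * Real.pi)) x = x := by
  conv_lhs => rw [← rotZ_two_pi' x]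
  rw [rotZ_neg_rotZ']

/-- `(θ, x) ↦ R_θ x` is jointly continuous (re-proved with a light import closure; cf. the tree's `continuous_rotZ_uncurry`). -/
private theorem continuous_rotZ_uncurry' : Continuous fun q : ℝ × EuclideanSpace ℝ (Fin 3) => rotZ q.1 q.2 := by
  unfold rotZ
  refine (PiLp.continuous_toLp 2 _).comp ?_
  refine continuous_pi fun i => ?_
  have h0 : Continuous fun q : ℝ × EuclideanSpace ℝ (Fin 3) => q.2 0 := (PiLp.continuous_apply 2 _ 0).comp continuous_snd
  have h1 : Continuous fun q : ℝ × EuclideanSpace ℝ (Fin 3) => q.2 1 := (PiLp.continuous_apply 2 _ 1).comp continuous_snd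
  have h2 : Continuous fun q : ℝ × EuclideanSpace ℝ (Fin 3) => q.2 2 := (PiLp.continuous_apply 2 _ 2).comp continuous_snd
  have hc : Continuous fun q : ℝ × EuclideanSpace ℝ (Fin 3) => Real.cos q.1 := Real.continuous_cos.comp continuous_fst
  have hs : Continuous fun q : ℝ × EuclideanSpace ℝ (Fin 3) => Real.sin q.1 := Real.continuous_sin.comp continuous_fst
  fin_cases i
  · exact ((hc.mul h0).sub (hs.mul h1)).congr fun q => by simp
  · exact ((hs.mul h0).add (hc.mul h1)).congr fun q => by simp
  · exact h2.congr fun q => by simp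

/-- Angle `0` is pure discrete self-similarity. -/
theorem isScrew_zero_iff {lam : ℝ} {v : ℝ → EuclideanSpace ℝ (Fin 3) → EuclideanSpace ℝ (Fin 3)} : IsScrew 0 lam v ↔ IsDss lam v := by
  simp only [IsScrew, IsDss, neg_zero, rotZ_zero]

/-- Angle `0` about a centre is DSS about that centre. -/
theorem isScrewAbout_zero_iff {c : EuclideanSpace ℝ (Fin 3)} {lam : ℝ} {v : ℝ → EuclideanSpace ℝ (Fin 3) → EuclideanSpace ℝ (Fin 3)} :
    IsScrewAbout c 0 lam v ↔ IsDssAbout c lam v := by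
  rw [IsScrewAbout, isScrew_zero_iff, isDssAbout_iff_translate]

/-- The identity element. -/
theorem isScrew_refl (v : ℝ → EuclideanSpace ℝ (Fin 3) → EuclideanSpace ℝ (Fin 3)) : IsScrew 0 1 v := fun t _ x => by simp

/-- Group law: `(θ₁, a) · (θ₂, b) = (θ₁ + θ₂, a b)` (rotations about one axis commute with each other and with scalings). -/
theorem _root_.Summit.NavierStokesRegularity.NavierStokesRegularity.Theorems.PoloidalWindowDoorPoloidalWindowRigidityNearIdentityDefs.IsScrew.mul {θ₁ θ₂ a b : ℝ} {v : ℝ → EuclideanSpace ℝ (Fin 3) → EuclideanSpace ℝ (Fin 3)} (h1 : IsScrew θ₁ a v) (ha : 0 < a)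
    (h2 : IsScrew θ₂ b v) : IsScrew (θ₁ + θ₂) (a * b) v := by
  intro t ht x
  have hat : a ^ 2 * t < 0 := mul_neg_of_pos_of_neg (pow_pos ha 2) ht
  have e1 : b • rotZ θ₂ (a • rotZ θ₁ x) = (a * b) • rotZ (θ₁ + θ₂) x := by
    rw [rotZ_smul', smul_smul, mul_comm b a, add_comm θ₁ θ₂, rotZ_add]
  have e2 : b ^ 2 * (a ^ 2 * t) = (a * b) ^ 2 * t := by ring
  calc v t x = a • rotZ (-θ₁) (v (a ^ 2 * t) (a • rotZ θ₁ x)) := h1 t ht x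
    _ = a • rotZ (-θ₁) (b • rotZ (-θ₂) (v (b ^ 2 * (a ^ 2 * t)) (b • rotZ θ₂ (a • rotZ θ₁ x)))) := by rw [h2 (a ^ 2 * t) hat (a • rotZ θ₁ x)]
    _ = (a * b) • rotZ (-(θ₁ + θ₂)) (v ((a * b) ^ 2 * t) ((a * b) • rotZ (θ₁ + θ₂) x)) := by
        rw [e1, e2, rotZ_smul', smul_smul, neg_add, rotZ_add, rotZ_add]

/-- Inverses: `(θ, a)⁻¹ = (−θ, a⁻¹)`. -/
theorem _root_.Summit.NavierStokesRegularity.NavierStokesRegularity.Theorems.PoloidalWindowDoorPoloidalWindowRigidityNearIdentityDefs.IsScrew.inv {θ a : ℝ} {v : ℝ → EuclideanSpace ℝ (Fin 3) → EuclideanSpace ℝ (Fin 3)} (h : IsScrew θ a v) (ha : 0 < a) : IsScrew (-θ) a⁻¹ v := by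
  intro t ht x
  have hat : a⁻¹ ^ 2 * t < 0 := mul_neg_of_pos_of_neg (pow_pos (inv_pos.2 ha) 2) ht
  have key := h (a⁻¹ ^ 2 * t) hat (a⁻¹ • rotZ (-θ) x)
  have e1 : a ^ 2 * (a⁻¹ ^ 2 * t) = t := by field_simp
  have e2 : a • rotZ θ (a⁻¹ • rotZ (-θ) x) = x := by
    rw [rotZ_smul', smul_smul, mul_inv_cancel₀ ha.ne', one_smul, rotZ_rotZ_neg']
  rw [e1, e2] at key
  rw [key, rotZ_smul', smul_smul, inv_mul_cancel₀ ha.ne', one_smul, neg_neg, rotZ_rotZ_neg']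

/-- Natural powers: `(θ, a)^k = (k θ, a^k)`. -/
theorem _root_.Summit.NavierStokesRegularity.NavierStokesRegularity.Theorems.PoloidalWindowDoorPoloidalWindowRigidityNearIdentityDefs.IsScrew.pow {θ a : ℝ} {v : ℝ → EuclideanSpace ℝ (Fin 3) → EuclideanSpace ℝ (Fin 3)} (h : IsScrew θ a v) (ha : 0 < a) :
    ∀ k : ℕ, IsScrew ((k : ℝ) * θ) (a ^ k) v := by
  intro k
  induction k with
  | zero => simpa using isScrew_refl v
  | succ k ih =>
      have e : (((k + 1 : ℕ) : ℝ)) * θ = (k : ℝ) * θ + θ := by push_cast; ring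
      rw [pow_succ, e]
      exact ih.mul (pow_pos ha k) h

/-- Integer powers. -/
theorem _root_.Summit.NavierStokesRegularity.NavierStokesRegularity.Theorems.PoloidalWindowDoorPoloidalWindowRigidityNearIdentityDefs.IsScrew.zpow {θ a : ℝ} {v : ℝ → EuclideanSpace ℝ (Fin 3) → EuclideanSpace ℝ (Fin 3)} (h : IsScrew θ a v) (ha : 0 < a) :
    ∀ k : ℤ, IsScrew ((k : ℝ) * θ) (a ^ k) v
  | (n : ℕ) => by
      rw [zpow_natCast, Int.cast_natCast]
      exact h.pow ha n
  | Int.negSucc n => by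
      rw [zpow_negSucc, Int.cast_negSucc, neg_mul]
      have := (h.pow ha (n + 1)).inv (pow_pos ha _)
      push_cast at this ⊢
      exact this

/-- Finite rotational invariance by every angle is axisymmetry of every slice (tree `IsAxisymmetric`: `u (R_θ x) = R_θ (u x)`). -/
theorem isAxisymmetric_of_isScrew {U : ℝ → EuclideanSpace ℝ (Fin 3) → EuclideanSpace ℝ (Fin 3)} (h : ∀ θ : ℝ, IsScrew θ 1 U) :
    ∀ t < 0, IsAxisymmetric (U t) := by
  intro t ht θ x
  have key := h θ t ht x
  simp only [one_pow, one_mul, one_smul] at key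
  rw [key, rotZ_rotZ_neg']

/-- **A rotating scaling soliton is DISCRETELY self-similar** (Pineau–Vicol 2026 Remark 1.5: RSS ⊆ DSS): invariance under `(ασ, e^σ)` for all `σ`, `α ≠ 0`,
gives pure `λ₀`-DSS with `λ₀ = e^{2π/|α|}` (one full turn). -/
theorem isDss_of_soliton {α : ℝ} {U : ℝ → EuclideanSpace ℝ (Fin 3) → EuclideanSpace ℝ (Fin 3)} (hα : α ≠ 0)
    (h : ∀ σ : ℝ, IsScrew (α * σ) (Real.exp σ) U) : IsDss (Real.exp (2 * Real.pi / |α|)) U := by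
  intro t ht x
  rcases lt_or_gt_of_ne hα with hneg | hpos
  · have e : α * (2 * Real.pi / |α|) = -(2 * Real.pi) := by rw [abs_of_neg hneg]; field_simp
    have key := h (2 * Real.pi / |α|) t ht x
    rw [e, neg_neg, rotZ_two_pi', rotZ_neg_two_pi'] at key
    exact key
  · have e : α * (2 * Real.pi / |α|) = 2 * Real.pi := by rw [abs_of_pos hpos]; field_simp
    have key := h (2 * Real.pi / |α|) t ht x
    rw [e, rotZ_two_pi', rotZ_neg_two_pi'] at key
    exact key

/-! ## §33 NEAR-IDENTITY SYMMETRIES INTEGRATE TO A ONE-PARAMETER SYMMETRY OF THE LIMIT (PROVED) — the Chabauty / one-parameter-subgroup extraction: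
if class profiles `vⱼ` are `gⱼ = (θⱼ, λⱼ)`-screw invariant with `gⱼ → e`, `gⱼ ≠ e`, and `(θⱼ, log λⱼ)/εⱼ → (p, q)` (`εⱼ = |θⱼ| + |log λⱼ|`), then every
pointwise limit `U` is invariant under the whole one-parameter subgroup `τ ↦ (pτ, e^{qτ})` — integer powers `gⱼ^{kⱼ}`, `kⱼ = ⌊τ/εⱼ⌋`, and the class-uniform
joint modulus (`…HotHullSlabUniform.exists_uniform_slab_modulus`, KNSS (4.10)/(4.11)) -/

/-- **Closedness of screw symmetry under class limits with MOVING group elements (PROVED):** if class-`C` profiles `vs j`, each `(θ'ⱼ, μⱼ)`-screw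
invariant, converge pointwise on the open slab to `U`, and `θ'ⱼ → Θ`, `μⱼ → μ > 0`, then `U` is `(Θ, μ)`-screw invariant — the relation passes to the limit by
the CLASS-UNIFORM joint Lipschitz modulus on compact slabs (`…HotHullSlabUniform.exists_uniform_slab_modulus`) and the joint continuity of `(θ, x) ↦ R_θ x`. -/
theorem isScrew_of_limit (C : ℝ) {vs : ℕ → ℝ → EuclideanSpace ℝ (Fin 3) → EuclideanSpace ℝ (Fin 3)}
    {U : ℝ → EuclideanSpace ℝ (Fin 3) → EuclideanSpace ℝ (Fin 3)} {ths' mus : ℕ → ℝ} {Θ mu : ℝ}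
    (hrate : ∀ j, HasTypeITimeDecay C (vs j)) (hcont : ∀ j, ContinuousOn (Function.uncurry (vs j)) (Set.Iio (0 : ℝ) ×ˢ Set.univ))
    (hmild : ∀ j, ∀ s t : ℝ, s < t → t < 0 → ∀ x, vs j t x =
      UnboundedOperators.heatExtension (vs j s) (t - s) x - oseenDuhamel 1 s (vs j) (vs j) t x)
    (hdiv : ∀ j, ∀ t < 0, VectorCalculus.IsDivFree (vs j t))
    (hconv : ∀ t < 0, ∀ x, Tendsto (fun j => vs j t x) atTop (𝓝 (U t x)))
    (hd : ∀ j, IsScrew (ths' j) (mus j) (vs j)) (hθ : Tendsto ths' atTop (𝓝 Θ)) (hmu : Tendsto mus atTop (𝓝 mu)) (hmu0 : 0 < mu) :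
    IsScrew Θ mu U := by
  intro t ht x
  -- the compact slab carrying all the times `mus j ^ 2 * t` (eventually) and `mu ^ 2 * t`
  have hT0 : mu ^ 2 * t < 0 := mul_neg_of_pos_of_neg (pow_pos hmu0 2) ht
  obtain ⟨R, hR1, hR4T, hRinv⟩ : ∃ R : ℝ, 1 ≤ R ∧ -R ≤ 4 * (mu ^ 2 * t) ∧ mu ^ 2 * t / 4 ≤ -R⁻¹ := by
    refine ⟨max 1 (max (-(4 * (mu ^ 2 * t))) (4 / (-(mu ^ 2 * t)))), le_max_left _ _, ?_, ?_⟩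
    · have h1 := le_max_left (-(4 * (mu ^ 2 * t))) (4 / (-(mu ^ 2 * t)))
      have h2 := le_max_right 1 (max (-(4 * (mu ^ 2 * t))) (4 / (-(mu ^ 2 * t))))
      linarith
    · have h4 : 4 / (-(mu ^ 2 * t)) ≤ max 1 (max (-(4 * (mu ^ 2 * t))) (4 / (-(mu ^ 2 * t)))) :=
        (le_max_right _ _).trans (le_max_right _ _)
      have hR0 : 0 < max 1 (max (-(4 * (mu ^ 2 * t))) (4 / (-(mu ^ 2 * t)))) := lt_of_lt_of_le one_pos (le_max_left _ _)
      have h5 : (max 1 (max (-(4 * (mu ^ 2 * t))) (4 / (-(mu ^ 2 * t)))))⁻¹ ≤ (-(mu ^ 2 * t)) / 4 := by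
        rw [inv_le_comm₀ hR0 (by linarith), inv_div]
        exact h4
      linarith
  obtain ⟨M, hM0, hM⟩ := PoloidalWindowDoorPoloidalWindowRigidityHotHullSlabUniform.exists_uniform_slab_modulus C hR1
  have hTmem : mu ^ 2 * t ∈ Set.Icc (-R) (-R⁻¹) := ⟨by linarith, by linarith⟩
  -- eventually `mu / 2 < mus j < 2 mu`, hence `mus j ^ 2 * t ∈ [4 mu² t, mu² t / 4] ⊆ [-R, -R⁻¹]`
  have hev1 : ∀ᶠ j in atTop, mu / 2 < mus j := hmu.eventually (lt_mem_nhds (by linarith))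
  have hev2 : ∀ᶠ j in atTop, mus j < 2 * mu := hmu.eventually (gt_mem_nhds (by linarith))
  have hmem : ∀ᶠ j in atTop, mus j ^ 2 * t ∈ Set.Icc (-R) (-R⁻¹) := by
    filter_upwards [hev1, hev2] with j hj1 hj2
    have hmj0 : 0 < mus j := by linarith
    have hsq_le : mus j ^ 2 ≤ (2 * mu) ^ 2 := pow_le_pow_left₀ hmj0.le hj2.le 2
    have hsq_ge : (mu / 2) ^ 2 ≤ mus j ^ 2 := pow_le_pow_left₀ (by linarith) hj1.le 2
    constructor
    · nlinarith
    · nlinarith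
  -- the moving arguments converge: `mus j • R_{ths' j} x → mu • R_Θ x`
  have hrot : Tendsto (fun j => rotZ (ths' j) x) atTop (𝓝 (rotZ Θ x)) := by
    -- (named intermediate: a direct term makes the unifier solve `(?f j).1 = ths' j` by unfolding `rotZ`)
    have h1 : Tendsto (fun j => (ths' j, x)) atTop (𝓝 (Θ, x)) := hθ.prodMk_nhds tendsto_const_nhds
    have h2 := (continuous_rotZ_uncurry'.tendsto (Θ, x)).comp h1
    exact h2
  have hyj : Tendsto (fun j => mus j • rotZ (ths' j) x) atTop (𝓝 (mu • rotZ Θ x)) := hmu.smul hrot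
  -- `A j := vs j (mus j ^ 2 * t) (mus j • R_{ths' j} x)` is close to `B j := vs j (mu ^ 2 * t) (mu • R_Θ x)`, which tends to `U (mu ^ 2 * t) (mu • R_Θ x)`
  have hAB : Tendsto (fun j => vs j (mus j ^ 2 * t) (mus j • rotZ (ths' j) x) - vs j (mu ^ 2 * t) (mu • rotZ Θ x)) atTop (𝓝 0) := by
    have hbound : ∀ᶠ j in atTop, ‖vs j (mus j ^ 2 * t) (mus j • rotZ (ths' j) x) - vs j (mu ^ 2 * t) (mu • rotZ Θ x)‖ ≤
        M * (|mus j ^ 2 * t - mu ^ 2 * t| + ‖mus j • rotZ (ths' j) x - mu • rotZ Θ x‖) := by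
      filter_upwards [hmem] with j hj
      exact hM (hrate j) (hcont j) (hmild j) (hdiv j) _ hj _ hTmem _ _
    have hlim0 : Tendsto (fun j => M * (|mus j ^ 2 * t - mu ^ 2 * t| + ‖mus j • rotZ (ths' j) x - mu • rotZ Θ x‖)) atTop (𝓝 0) := by
      have h1 : Tendsto (fun j => mus j ^ 2 * t - mu ^ 2 * t) atTop (𝓝 (mu ^ 2 * t - mu ^ 2 * t)) := ((hmu.pow 2).mul_const t).sub_const _
      have h2 : Tendsto (fun j => mus j • rotZ (ths' j) x - mu • rotZ Θ x) atTop (𝓝 (mu • rotZ Θ x - mu • rotZ Θ x)) := hyj.sub_const _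
      have h3 := (h1.abs.add h2.norm).const_mul M
      simpa using h3
    exact squeeze_zero_norm' hbound hlim0
  have hB : Tendsto (fun j => vs j (mu ^ 2 * t) (mu • rotZ Θ x)) atTop (𝓝 (U (mu ^ 2 * t) (mu • rotZ Θ x))) := hconv _ hT0 _
  have hA : Tendsto (fun j => vs j (mus j ^ 2 * t) (mus j • rotZ (ths' j) x)) atTop (𝓝 (U (mu ^ 2 * t) (mu • rotZ Θ x))) := by
    have h := hAB.add hB
    simp only [sub_add_cancel, zero_add] at h
    exact h
  -- rotate back and rescale
  have hrot' : Tendsto (fun j => rotZ (-ths' j) (vs j (mus j ^ 2 * t) (mus j • rotZ (ths' j) x))) atTop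
      (𝓝 (rotZ (-Θ) (U (mu ^ 2 * t) (mu • rotZ Θ x)))) := by
    have h1 : Tendsto (fun j => (-ths' j, vs j (mus j ^ 2 * t) (mus j • rotZ (ths' j) x))) atTop (𝓝 (-Θ, U (mu ^ 2 * t) (mu • rotZ Θ x))) :=
      hθ.neg.prodMk_nhds hA
    have h2 := (continuous_rotZ_uncurry'.tendsto (-Θ, U (mu ^ 2 * t) (mu • rotZ Θ x))).comp h1
    exact h2
  have h5 : Tendsto (fun j => vs j t x) atTop (𝓝 (mu • rotZ (-Θ) (U (mu ^ 2 * t) (mu • rotZ Θ x)))) := by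
    have e : (fun j => vs j t x) = fun j => mus j • rotZ (-ths' j) (vs j (mus j ^ 2 * t) (mus j • rotZ (ths' j) x)) :=
      funext fun j => hd j t ht x
    rw [e]
    exact hmu.smul hrot'
  exact tendsto_nhds_unique (hconv t ht x) h5

/-- Integer multiples of vanishing steps reach every real number: `⌊τ/εⱼ⌋ εⱼ → τ` as `εⱼ → 0⁺`. -/
theorem tendsto_floor_mul {eps : ℕ → ℝ} (heps : ∀ j, 0 < eps j) (heps0 : Tendsto eps atTop (𝓝 0)) (τ : ℝ) :
    Tendsto (fun j => ((⌊τ / eps j⌋ : ℤ) : ℝ) * eps j) atTop (𝓝 τ) := by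
  have hb : ∀ j, |((⌊τ / eps j⌋ : ℤ) : ℝ) * eps j - τ| ≤ eps j := by
    intro j
    have hε := heps j
    have h1 : ((⌊τ / eps j⌋ : ℤ) : ℝ) ≤ τ / eps j := Int.floor_le _
    have h2 : τ / eps j < ((⌊τ / eps j⌋ : ℤ) : ℝ) + 1 := Int.lt_floor_add_one _
    rw [le_div_iff₀ hε] at h1
    rw [div_lt_iff₀ hε, add_mul, one_mul] at h2
    rw [abs_le]
    constructor <;> linarith
  have h0 : Tendsto (fun j => ((⌊τ / eps j⌋ : ℤ) : ℝ) * eps j - τ) atTop (𝓝 0) :=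
    squeeze_zero_norm (fun j => by rw [Real.norm_eq_abs]; exact hb j) heps0
  have h1 := h0.add_const τ
  simp only [sub_add_cancel, zero_add] at h1
  exact h1

/-- **One-parameter symmetry of the limit (PROVED).** -/
theorem oneParameter_of_limit (C : ℝ) {vs : ℕ → ℝ → EuclideanSpace ℝ (Fin 3) → EuclideanSpace ℝ (Fin 3)}
    {U : ℝ → EuclideanSpace ℝ (Fin 3) → EuclideanSpace ℝ (Fin 3)} {ths lams eps : ℕ → ℝ} {p q : ℝ}
    (hrate : ∀ j, HasTypeITimeDecay C (vs j)) (hcont : ∀ j, ContinuousOn (Function.uncurry (vs j)) (Set.Iio (0 : ℝ) ×ˢ Set.univ))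
    (hmild : ∀ j, ∀ s t : ℝ, s < t → t < 0 → ∀ x, vs j t x =
      UnboundedOperators.heatExtension (vs j s) (t - s) x - oseenDuhamel 1 s (vs j) (vs j) t x)
    (hdiv : ∀ j, ∀ t < 0, VectorCalculus.IsDivFree (vs j t))
    (hconv : ∀ t < 0, ∀ x, Tendsto (fun j => vs j t x) atTop (𝓝 (U t x)))
    (hscrew : ∀ j, IsScrew (ths j) (lams j) (vs j)) (hl : ∀ j, 0 < lams j)
    (heps : ∀ j, 0 < eps j) (heps0 : Tendsto eps atTop (𝓝 0))
    (hp : Tendsto (fun j => ths j / eps j) atTop (𝓝 p)) (hq : Tendsto (fun j => Real.log (lams j) / eps j) atTop (𝓝 q)) :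
    ∀ τ : ℝ, IsScrew (p * τ) (Real.exp (q * τ)) U := by
  intro τ
  -- integer exponents `k j = ⌊τ / eps j⌋`, so that `k j * eps j → τ`
  have hkε := tendsto_floor_mul heps heps0 τ
  -- the angles `k j * ths j → p * τ`
  have hθ : Tendsto (fun j => ((⌊τ / eps j⌋ : ℤ) : ℝ) * ths j) atTop (𝓝 (p * τ)) := by
    have e : (fun j => ((⌊τ / eps j⌋ : ℤ) : ℝ) * ths j) = fun j => ((⌊τ / eps j⌋ : ℤ) : ℝ) * eps j * (ths j / eps j) := by
      funext j
      rw [mul_assoc, mul_div_assoc', mul_div_cancel_left₀ _ (heps j).ne']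
    rw [e, mul_comm p τ]
    exact hkε.mul hp
  -- the factors `lams j ^ k j → exp (q * τ)`
  have hmu : Tendsto (fun j => lams j ^ (⌊τ / eps j⌋ : ℤ)) atTop (𝓝 (Real.exp (q * τ))) := by
    have e : (fun j => lams j ^ (⌊τ / eps j⌋ : ℤ)) = fun j => Real.exp (((⌊τ / eps j⌋ : ℤ) : ℝ) * eps j * (Real.log (lams j) / eps j)) := by
      funext j
      rw [mul_assoc, mul_div_assoc', mul_div_cancel_left₀ _ (heps j).ne', ← Real.log_zpow, Real.exp_log (zpow_pos (hl j) _)]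
    have h1 : Tendsto (fun j => ((⌊τ / eps j⌋ : ℤ) : ℝ) * eps j * (Real.log (lams j) / eps j)) atTop (𝓝 (q * τ)) := by
      rw [mul_comm q τ]
      exact hkε.mul hq
    have h2 : Tendsto (fun j => Real.exp (((⌊τ / eps j⌋ : ℤ) : ℝ) * eps j * (Real.log (lams j) / eps j))) atTop (𝓝 (Real.exp (q * τ))) :=
      (Real.continuous_exp.tendsto _).comp h1
    rw [e]
    exact h2
  exact isScrew_of_limit C hrate hcont hmild hdiv hconv (fun j => (hscrew j).zpow (hl j) ⌊τ / eps j⌋) hθ hmu (Real.exp_pos _)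

/-! ## §34 THE THREE ENDS OF A ONE-PARAMETER SYMMETRY: axisymmetric (PROVED absurd, tree `AxisymEndLiouville` stubs by name), self-similar (PROVED absurd,
LINE 28 / `…Strata`), rotating scaling soliton — FAST ones PROVED absurd (one full turn is a FINE pure DSS factor, LINE 28's `nearOne_anchor`), SLOW ones = HAND H1 -/

/-- **FAST rotating scaling solitons are absurd, decay-free (PROVED):** for every `C, A, a > 0` there is `α₀(C,A,a)` such that no class-`C` profile with an
anchor `‖U(−1,x₀)‖ ≥ a`, `‖x₀‖ ≤ A`, is invariant under the soliton group `(ασ, e^σ)_σ` with `|α| > α₀`: one full turn is the pure DSS factor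
`e^{2π/|α|} ∈ (1, λ_*(C,A,a))` (LINE 28's `nearOne_anchor`).  The slow range `0 < |α| ≤ α₀` is HAND H1. -/
theorem noScrewSoliton_fast (C A a : ℝ) (ha : 0 < a) :
    ∃ α₀ : ℝ, 0 < α₀ ∧ ∀ (U : ℝ → EuclideanSpace ℝ (Fin 3) → EuclideanSpace ℝ (Fin 3)) (α : ℝ) (x₀ : EuclideanSpace ℝ (Fin 3)),
      HasTypeITimeDecay C U → ContinuousOn (Function.uncurry U) (Set.Iio (0 : ℝ) ×ˢ Set.univ) →
      (∀ s t : ℝ, s < t → t < 0 → ∀ x, U t x = UnboundedOperators.heatExtension (U s) (t - s) x - oseenDuhamel 1 s U U t x) →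
      (∀ t < 0, VectorCalculus.IsDivFree (U t)) →
      ‖x₀‖ ≤ A → a ≤ ‖U (-1) x₀‖ → α₀ < |α| → (∀ σ : ℝ, IsScrew (α * σ) (Real.exp σ) U) → False := by
  obtain ⟨lamStar, h1, H⟩ := nearOne_anchor C A a ha
  have hlog : 0 < Real.log lamStar := Real.log_pos h1
  refine ⟨2 * Real.pi / Real.log lamStar, by positivity, ?_⟩
  intro U α x₀ hrate hcont hmild hdiv hx hanc hα hsol
  have hαpos : 0 < |α| := lt_trans (by positivity) hα
  have hα0 : α ≠ 0 := abs_pos.1 hαpos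
  have hd := isDss_of_soliton hα0 hsol
  have hgt : 1 < Real.exp (2 * Real.pi / |α|) := Real.one_lt_exp_iff.2 (by positivity)
  have hlt : Real.exp (2 * Real.pi / |α|) < lamStar := by
    have h2 : 2 * Real.pi / |α| < Real.log lamStar := by
      rw [div_lt_iff₀ hαpos]
      have h3 := (div_lt_iff₀ hlog).1 hα
      linarith [mul_comm |α| (Real.log lamStar)]
    calc Real.exp (2 * Real.pi / |α|) < Real.exp (Real.log lamStar) := Real.exp_lt_exp.2 h2
      _ = lamStar := Real.exp_log (by linarith)
  exact H U _ x₀ hrate hcont hmild hdiv hx hanc hgt hlt hd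


end Summit.NavierStokesRegularity.NavierStokesRegularity.Theorems.PoloidalWindowDoorPoloidalWindowRigidityNearIdentityExtraction

end
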